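import Summits.QuantumFields.YangMills.Theorems.UnitScaleTiltFluctuationComparisonRegPrLiftLoops
import Summits.QuantumFields.YangMills.Theorems.UnitScaleTiltAvgActionDefectLoops
import Literature.MathematicalPhysics.QuantumFieldTheory.Balaban1983to89.BlockAveragingSectionPlaq

/-!
# Route `UnitScaleTilt` — crux K1bR-pr `FluctuationComparisonRegPr` (stmt-QuantumFields-19201), stub `stub_oneStepSmallLift`
# (W7 line), piece (L2), layer F1: THE (0.4) LOOP VARIABLES AND THE STRAIGHT TRANSPORTER OF A FACE-SUPPORTED CORRECTED SECTION
# `U⋆ = E · faceSec V` ARE EXPLICIT (support file `--supports stmt-QuantumFields-19201`)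

Fleet seat `ym-ust-19201-p1` gen 2 (lead of the `[M]` stub; CARD-19201-oneStepSmallLift-L1L2 §2–§3, face-supported base).  The
approximate one-step lift of the card is `U⋆ = E · faceSec V` with a correction `E = exp ζ` supported on the block EXIT bonds
(`supp faceSec`; the certified linear kernels `CertL3Face`, `CertL5` live there).  For such `E` every object of Bałaban's (0.4)
block averaging [Balaban1987RG1] at a coarse bond `c` is EXPLICIT — no expansion, exact group identities in any gauge group:

* §1 `ExitSupported E` (`E b = 1` off `ExitsBlock`); the exit bond `exitBond c r` of the face of `c` at transverse offsets `r`
  (`r (c.dir)` is ignored), `exitsBlock_exitBond`, `faceSec_exitBond : faceSec V (exitBond c r) = V c`.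
* §2 staircases never leave their block: `not_exitsBlock_of_mem_stairWalk`, hence `holAt U⋆ (Γ^σ_{y,r}) = 1`
  (`holAt_stairWalk_eq_one`).
* §3 rows: the straight path of `L` bonds from the block site `x_r` in direction `μ` meets exactly ONE exit bond, `exitBond ⟨y,μ⟩ r`
  (`shiftN_blockSite`, `exitsBlock_row_iff`), so `rowProd U⋆ x_r μ L = E (exitBond c r) · V c` (`rowProd_mulField_faceSec`) and
  **`axialAvg U⋆ c = E (exitBond c r₀) · V c`** (`axialAvg_mulField_faceSec`, `r₀ =` the centre offsets `ctr P`).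
* §4 **`loopHol_mulField_faceSec`**: `W_c(r, σ, σ′)(U⋆) = E (exitBond c r) · E (exitBond c r₀)⁻¹` — independent of the orderings
  (p1 g8's factorisation `AvgActionDefect.loopHol_eq`); `mean_idx_eq_mean_offsets`: a mean over `Idx P` of a function of the offset is the
  mean over the `L^d` offsets (how the S-neutrality «face sums of ζ vanish» enters the averaging estimate of layer F2).

Elementary lattice geometry; nothing of Bałaban's is asserted.
-/

noncomputable section

open scoped BigOperators

namespace Summit.QuantumFields.YangMills.Theorems.ApproxLift

open Literature.MathematicalPhysics.QuantumFieldTheory.Balaban1983to89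
open T4Continuum BlockAveraging AveragingRT B10Eq47AxialChi BlockAveragingSection BlockAveragingSectionPlaq
open Summit.QuantumFields.YangMills.Theorems.AvgActionDefect (shiftN_apply holAt_walk_replicate blockSite_shift loopHol_eq)

variable {P : Params} {j : ℕ} {G : Type*} [GaugeGroup G]

/-! ## §1 Exit-supported corrections and the exit bonds of a face -/

/-- A fine configuration SUPPORTED ON THE BLOCK EXIT BONDS: `E b = 1` whenever `b` does not exit its block (the support of
`faceSec`; the certified face-supported linear kernels produce corrections `E = exp ζ` of this kind). -/
def ExitSupported (E : GaugeField P j G) : Prop := ∀ b : PBond P j, ¬ ExitsBlock b → E b = 1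

/-- The last in-block position `L − 1 ∈ {0,…,L−1}`. -/
def lastPos (P : Params) : Fin P.L := ⟨P.L - 1, by have := P.hL.2; omega⟩

/-- The centre offsets `((L−1)/2, …, (L−1)/2)` (the block centre `emb y = blockSite y (ctr P)`). -/
def ctr (P : Params) : Fin P.d → Fin P.L := fun _ => ⟨(P.L - 1) / 2, half_lt P⟩

/-- `emb y` is the block site at the centre offsets (definitional). -/
theorem emb_eq_blockSite_ctr (y : Site P (j + 1)) : emb y = Site.blockSite y (ctr P) := rfl

/-- **THE EXIT BOND OF THE FACE OF `c` AT TRANSVERSE OFFSETS `r`**: the bond in direction `c.dir` from the block site of `B(c₋)` with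
offsets `r` off `c.dir` and `L − 1` in direction `c.dir` (the component `r (c.dir)` is ignored). -/
def exitBond (c : PBond P (j + 1)) (r : Fin P.d → Fin P.L) : PBond P j :=
  ⟨Site.blockSite c.src (Function.update r c.dir (lastPos P)), c.dir⟩

/-- `exitBond c r` does not depend on `r (c.dir)`. -/
theorem exitBond_update (c : PBond P (j + 1)) (r : Fin P.d → Fin P.L) (k : Fin P.L) :
    exitBond c (Function.update r c.dir k) = exitBond c r := by
  unfold exitBond
  rw [Function.update_idem]

/-- The exit bond exits its block. -/
theorem exitsBlock_exitBond (hj : j + 1 ≤ P.m + P.K) (c : PBond P (j + 1)) (r : Fin P.d → Fin P.L) :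
    ExitsBlock (exitBond c r) := by
  rw [exitsBlock_iff]
  show offset (Site.blockSite c.src (Function.update r c.dir (lastPos P))) c.dir = P.L - 1
  rw [offset_blockSite hj, Function.update_self]
  rfl

/-- The exit bond issues from `B(c₋)`. -/
theorem blockOf_exitBond_src (hj : j + 1 ≤ P.m + P.K) (c : PBond P (j + 1)) (r : Fin P.d → Fin P.L) :
    blockOf (exitBond c r).src = c.src :=
  Site.blockOf_blockSite hj _ _

/-- **`faceSec V (exitBond c r) = V c`**. -/
theorem faceSec_exitBond (hj : j + 1 ≤ P.m + P.K) (V : GaugeField P (j + 1) G) (c : PBond P (j + 1))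
    (r : Fin P.d → Fin P.L) : faceSec V (exitBond c r) = V c := by
  rw [faceSec_of_exits V (exitsBlock_exitBond hj c r)]
  show V ⟨blockOf (exitBond c r).src, c.dir⟩ = V c
  rw [blockOf_exitBond_src hj]

/-- Off the exit bonds `E · faceSec V` is trivial. -/
theorem mulField_faceSec_of_not_exits {E : GaugeField P j G} (hE : ExitSupported E) (V : GaugeField P (j + 1) G)
    {b : PBond P j} (hb : ¬ ExitsBlock b) : mulField E (faceSec V) b = 1 := by
  rw [mulField_apply, hE b hb, faceSec_of_not_exits V hb, one_mul]

/-! ## §2 Staircases never leave their block -/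

/-- **NO BOND OF A STAIRCASE `Γ^σ_{y,x}` (from the centre `emb y` to a site `x = blockSite y r` of `B(y)`) EXITS ITS BLOCK**: all prefix
end points lie in the box of half-width `(L−1)/2` around the centre, so a step in direction `d` issues from in-block position `≤ L − 2`
in that direction (standing range). -/
theorem not_exitsBlock_of_mem_stairWalk (hj : j + 1 ≤ P.m + P.K) (y : Site P (j + 1)) (σ : Equiv.Perm (Fin P.d))
    (r : Fin P.d → Fin P.L) (s : LStep P j) (hs : s ∈ walk (emb y) (stairWord σ (off r))) : ¬ ExitsBlock s.bond := by
  have hL := AveragingRT.two_mul_half_add_one P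
  have hL1 := P.hL.2
  obtain ⟨k₁, k₂, hsrc, hdisp⟩ := exists_take_of_mem_walk _ _ s hs
  set h : ℕ := (P.L - 1) / 2 with hh
  set e : Fin P.d → ℤ := fun κ => netDisp ((stairWord σ (off r)).take k₁) κ with he_def
  have hb : ∀ κ, -(h : ℤ) ≤ e κ ∧ e κ ≤ (h : ℤ) := fun κ => by
    have h1 := netDisp_take_stairWord σ (off r) κ k₁
    have h2 := off_bounds r κ
    rw [← hh] at h2
    constructor
    · exact le_trans (le_min (by omega) h2.1) h1.1
    · exact le_trans h1.2 (max_le (by omega) h2.2)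
  have hd : e s.bond.dir + 1 ≤ (h : ℤ) := by
    have h1 := (netDisp_take_stairWord σ (off r) s.bond.dir k₂).2
    rw [hdisp s.bond.dir, if_pos rfl] at h1
    have h2 := (off_bounds r s.bond.dir).2
    rw [← hh] at h2
    exact le_trans h1 (max_le (by omega) h2)
  have hsrcν : ∀ ν, s.bond.src ν = emb y ν + ((e ν : ℤ) : ZMod (P.sitesPerDir j)) := fun ν => by
    rw [hsrc, walkEnd_apply]
  have hoff := val_mod_of_near_emb hj y s.bond.src e hsrcν hb s.bond.dir
  rw [← hh] at hoff
  intro hex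
  have hexv : ((s.bond.src s.bond.dir).val % P.L : ℕ) = P.L - 1 := hex
  rw [hexv] at hoff
  push_cast [hL1.le] at hoff
  omega

/-- Holonomies of the trivial configuration are trivial (local copy). -/
private theorem holAt_one' (γ : List (LStep P j)) : holAt (1 : GaugeField P j G) γ = 1 := by
  induction γ with
  | nil => exact holAt_nil _
  | cons s γ ih =>
    rw [holAt_cons, ih, mul_one]
    show (if s.fwd then (1 : G) else (1 : G)⁻¹) = 1
    rw [inv_one]
    split_ifs <;> rfl

/-- Hence an exit-supported corrected section is `1` on every bond of every staircase, and **`U⋆(Γ^σ_{y,r}) = 1`**. -/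
theorem holAt_stairWalk_eq_one (hj : j + 1 ≤ P.m + P.K) {E : GaugeField P j G} (hE : ExitSupported E)
    (V : GaugeField P (j + 1) G) (y : Site P (j + 1)) (σ : Equiv.Perm (Fin P.d)) (r : Fin P.d → Fin P.L) :
    holAt (mulField E (faceSec V)) (walk (emb y) (stairWord σ (off r))) = 1 := by
  rw [T4ReflectionCone.holAt_congr (V' := (1 : GaugeField P j G)) fun s hs =>
    mulField_faceSec_of_not_exits hE V (not_exitsBlock_of_mem_stairWalk hj y σ r s hs)]
  exact holAt_one' _

/-! ## §3 Rows: the straight path from a block site meets exactly one exit bond -/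

/-- Iterated shifts add up. -/
theorem shiftN_add (x : Site P j) (μ : Fin P.d) (a : ℕ) : ∀ b : ℕ, shiftN x μ (a + b) = shiftN (shiftN x μ a) μ b
  | 0 => rfl
  | b + 1 => by rw [← Nat.add_assoc, shiftN_succ, shiftN_add x μ a b, shiftN_succ]

/-- **`blockSite y r + t e_μ = blockSite y (r + t e_μ)`** while `r_μ + t < L` (no carry). -/
theorem shiftN_blockSite (y : Site P (j + 1)) (r : Fin P.d → Fin P.L) (μ : Fin P.d) {t : ℕ}
    (ht : (r μ : ℕ) + t < P.L) :
    shiftN (Site.blockSite y r) μ t = Site.blockSite y (Function.update r μ ⟨r μ + t, ht⟩) := by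
  funext ν
  rw [shiftN_apply]
  by_cases hν : ν = μ
  · subst hν
    simp only [Site.blockSite, Function.update_self, if_true]
    push_cast
    ring
  · simp only [Site.blockSite, Function.update_of_ne hν, if_neg hν, add_zero]

/-- With a carry: `blockSite y r + t e_μ = blockSite (y + e_μ) (r + (t − L) e_μ)` when `r_μ + t = L + k`, `k < L` (standing range). -/
theorem shiftN_blockSite_carry (hj : j + 1 ≤ P.m + P.K) (y : Site P (j + 1)) (r : Fin P.d → Fin P.L) (μ : Fin P.d) {t : ℕ}
    (k : Fin P.L) (hk : (r μ : ℕ) + t = P.L + k) :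
    shiftN (Site.blockSite y r) μ t = Site.blockSite (y.shift μ) (Function.update r μ k) := by
  -- `blockSite y r = blockSite y r⁰ + r_μ e_μ` with `r⁰ = r[μ ↦ 0]`
  set r0 : Fin P.d → Fin P.L := Function.update r μ ⟨0, P.L_pos⟩ with hr0
  have hr00 : (r0 μ : ℕ) = 0 := by rw [hr0, Function.update_self]
  have hlt : (r0 μ : ℕ) + (r μ : ℕ) < P.L := by rw [hr00, zero_add]; exact (r μ).isLt
  have h0 : Site.blockSite y r = shiftN (Site.blockSite y r0) μ (r μ) := by
    rw [shiftN_blockSite y r0 μ hlt]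
    congr 1
    funext ν
    by_cases hν : ν = μ
    · subst hν; rw [Function.update_self]; apply Fin.ext; simp [hr00]
    · rw [Function.update_of_ne hν, hr0, Function.update_of_ne hν]
  have hlt' : (r0 μ : ℕ) + (k : ℕ) < P.L := by rw [hr00, zero_add]; exact k.isLt
  rw [h0, ← shiftN_add, hk, shiftN_add, ← blockSite_shift hj, shiftN_blockSite (y.shift μ) r0 μ hlt']
  congr 1
  funext ν
  by_cases hν : ν = μ
  · subst hν; rw [Function.update_self, Function.update_self]; apply Fin.ext; simp [hr00]
  · rw [Function.update_of_ne hν, Function.update_of_ne hν, hr0, Function.update_of_ne hν]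

/-- **THE ROW MEETS EXACTLY ONE EXIT BOND**: for `t < L`, the `t`-th bond of the straight path from `blockSite y r` in direction `μ`
exits its block iff `t = L − 1 − r_μ` (standing range). -/
theorem exitsBlock_row_iff (hj : j + 1 ≤ P.m + P.K) (y : Site P (j + 1)) (r : Fin P.d → Fin P.L) (μ : Fin P.d) {t : ℕ}
    (ht : t < P.L) :
    ExitsBlock (⟨shiftN (Site.blockSite y r) μ t, μ⟩ : PBond P j) ↔ t = P.L - 1 - (r μ : ℕ) := by
  have hr := (r μ).isLt
  rw [exitsBlock_iff]
  show offset (shiftN (Site.blockSite y r) μ t) μ = P.L - 1 ↔ _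
  by_cases hc : (r μ : ℕ) + t < P.L
  · rw [shiftN_blockSite y r μ hc, offset_blockSite hj, Function.update_self]
    simp only
    omega
  · rw [shiftN_blockSite_carry hj y r μ ⟨(r μ : ℕ) + t - P.L, by omega⟩ (by simp only; omega), offset_blockSite hj,
      Function.update_self]
    simp only
    omega

/-- At `t = L − 1 − r_μ` the row bond IS `exitBond ⟨y, μ⟩ r`. -/
theorem row_exitBond (y : Site P (j + 1)) (r : Fin P.d → Fin P.L) (μ : Fin P.d) :
    (⟨shiftN (Site.blockSite y r) μ (P.L - 1 - (r μ : ℕ)), μ⟩ : PBond P j) = exitBond ⟨y, μ⟩ r := by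
  have hr := (r μ).isLt
  have hlt : (r μ : ℕ) + (P.L - 1 - (r μ : ℕ)) < P.L := by omega
  have hfin : (⟨(r μ : ℕ) + (P.L - 1 - (r μ : ℕ)), hlt⟩ : Fin P.L) = lastPos P :=
    Fin.ext (by simp only [lastPos]; omega)
  rw [shiftN_blockSite y r μ hlt, hfin]
  rfl

/-- A row product all of whose factors but (at most) the `t⋆`-th are trivial. -/
theorem rowProd_eq_of_single (U : GaugeField P j G) (x : Site P j) (μ : Fin P.d) (t₀ : ℕ) :
    ∀ n : ℕ, (∀ t, t < n → t ≠ t₀ → U ⟨shiftN x μ t, μ⟩ = 1) →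
      rowProd U x μ n = if t₀ < n then U ⟨shiftN x μ t₀, μ⟩ else 1
  | 0, _ => by simp
  | n + 1, h => by
    rw [rowProd_succ, rowProd_eq_of_single U x μ t₀ n fun t ht hne => h t (Nat.lt_succ_of_lt ht) hne]
    by_cases hn : n = t₀
    · subst hn
      rw [if_neg (lt_irrefl _), if_pos (Nat.lt_succ_self _), one_mul]
    · rw [h n (Nat.lt_succ_self _) hn, mul_one]
      by_cases hlt : t₀ < n
      · rw [if_pos hlt, if_pos (Nat.lt_succ_of_lt hlt)]
      · rw [if_neg hlt, if_neg (by omega)]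

/-- **THE ROW PRODUCT OF A FACE-SUPPORTED CORRECTED SECTION**: `U⋆([x_r, x_r + L e_μ]) = E (exitBond c r) · V c` for `c = ⟨y, μ⟩`,
`x_r = blockSite y r` (standing range). -/
theorem rowProd_mulField_faceSec (hj : j + 1 ≤ P.m + P.K) {E : GaugeField P j G} (hE : ExitSupported E)
    (V : GaugeField P (j + 1) G) (c : PBond P (j + 1)) (r : Fin P.d → Fin P.L) :
    rowProd (mulField E (faceSec V)) (Site.blockSite c.src r) c.dir P.L = E (exitBond c r) * V c := by
  have hr := (r c.dir).isLt
  rw [rowProd_eq_of_single (mulField E (faceSec V)) (Site.blockSite c.src r) c.dir (P.L - 1 - (r c.dir : ℕ)) P.L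
      fun t ht hne => mulField_faceSec_of_not_exits hE V fun hex => hne ((exitsBlock_row_iff hj c.src r c.dir ht).mp hex),
    if_pos (by omega), row_exitBond c.src r c.dir, mulField_apply, faceSec_exitBond hj]

/-- **THE STRAIGHT TRANSPORTER**: `axialAvg U⋆ c = E (exitBond c r₀) · V c`, `r₀ = ctr P` (standing range). -/
theorem axialAvg_mulField_faceSec (hj : j + 1 ≤ P.m + P.K) {E : GaugeField P j G} (hE : ExitSupported E)
    (V : GaugeField P (j + 1) G) (c : PBond P (j + 1)) :
    axialAvg (mulField E (faceSec V)) c = E (exitBond c (ctr P)) * V c := by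
  rw [axialAvg_eq_holAt_walk, holAt_walk_replicate, emb_eq_blockSite_ctr, rowProd_mulField_faceSec hj hE V c (ctr P)]

/-! ## §4 The loop variables of (0.4) -/

/-- **THE (0.4) LOOP VARIABLES OF A FACE-SUPPORTED CORRECTED SECTION ARE EXPLICIT**:
`W_c(r, σ, σ′)(E · faceSec V) = E (exitBond c r) · E (exitBond c r₀)⁻¹` for every index (independent of the orderings `σ, σ′`;
standing range).  For `E = 1` this is `loopHol_faceSec` (`= 1`). -/
theorem loopHol_mulField_faceSec (hj : j + 1 ≤ P.m + P.K) {E : GaugeField P j G} (hE : ExitSupported E)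
    (V : GaugeField P (j + 1) G) (c : PBond P (j + 1)) (r : Fin P.d → Fin P.L) (σ σ' : Equiv.Perm (Fin P.d)) :
    loopHol (mulField E (faceSec V)) c (r, σ, σ') = E (exitBond c r) * (E (exitBond c (ctr P)))⁻¹ := by
  rw [loopHol_eq hj, holAt_stairWalk_eq_one hj hE V c.src σ r, holAt_stairWalk_eq_one hj hE V c.tgt σ' r,
    rowProd_mulField_faceSec hj hE V c r, axialAvg_mulField_faceSec hj hE V c]
  group

/-- `|Idx P| = L^d · (d!)²` as a real-free identity: `card (Idx P) = L^d · card (Perm × Perm)`. -/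
theorem card_idx_eq (P : Params) :
    Fintype.card (Idx P) = P.L ^ P.d * Fintype.card (Equiv.Perm (Fin P.d) × Equiv.Perm (Fin P.d)) := by
  rw [Fintype.card_prod, Fintype.card_fun, Fintype.card_fin, Fintype.card_fin]

/-- **A MEAN OVER `Idx P` OF A FUNCTION OF THE OFFSET IS THE MEAN OVER THE `L^d` OFFSETS** (vector-valued; the orderings `σ, σ′`
are dummy). -/
theorem mean_idx_eq_mean_offsets {𝔸 : Type*} [AddCommGroup 𝔸] [Module ℂ 𝔸] (f : (Fin P.d → Fin P.L) → 𝔸) :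
    ((Fintype.card (Idx P) : ℂ))⁻¹ • ∑ i : Idx P, f i.1 = (((P.L : ℂ) ^ P.d))⁻¹ • ∑ r : Fin P.d → Fin P.L, f r := by
  have hM : (Fintype.card (Equiv.Perm (Fin P.d) × Equiv.Perm (Fin P.d)) : ℂ) ≠ 0 := by
    exact_mod_cast Fintype.card_ne_zero
  rw [card_idx_eq, Fintype.sum_prod_type]
  simp only [Finset.sum_const, Finset.card_univ]
  rw [← Finset.smul_sum, ← Nat.cast_smul_eq_nsmul ℂ, smul_smul, Nat.cast_mul, Nat.cast_pow, mul_inv, mul_assoc,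
    inv_mul_cancel₀ hM, mul_one]

end Summit.QuantumFields.YangMills.Theorems.ApproxLift

end
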